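import Literature.NumberTheory.EllipticCurves.Kato2004.IwasawaCohomologyCoeff
import Literature.NumberTheory.GaloisRepresentations.ContinuousCorestrictionRelConj
import Mathlib.Algebra.Colimit.Module
import HarnessLib

/-!
# K-d glue at `S₀`, GENERIC half: Kato's trace map commutes with conjugation for ANY coefficient representation, and an EVENTUALLY-(P1)
# family of layer functionals glues to ONE additive functional on the direct limit (levels re-indexed from a floor `n₀`)

Route `ResidualThetaTransportAtTwo` (RTT), crux RSL_g `ResidualSignedLambdaLowerCMAtTwo` (stmt-BirchSwinnertonDyer-22608); width seat
`prover-bsd-wall-tp2-p2x-w3` g15 (`--supports 22608 --as helper`, closes nothing). THEOREMS ONLY (no definition, no named fact, no instance, no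
`sorry`). Stub plan rev 15–18 S60 (3) (K-d «GlueAwayTwo»: `locd_w`, `locd_{w,c}` become DEFINED, value-pinned, tower-independent functionals exactly
as `locd₂` did after K-c): this file is the COEFFICIENT-GENERIC half — §4b and §5 of the kernel-checked sketch
`Cruxes/ResidualThetaCountLowerPureAtTwo/Sketch_sidea_k2_g11.lean` transcribed (credit: stub-ideation k2 g11; its §1–§3 are
`…RhoLayerPairingProjectionCovOdd.lean`, its §4 `…RhoLayerPairingProjectionCov.lean`). The `ρ`-instantiation at a good place `w ∤ 2`
(`G i := H¹(U_{n_w+i,w}, A_ρ[2^k])` or the `k`-saturated model, `f := res`, `pair :=` the AwayTwo family, `n₀ := n_w`) is the LEAD's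
`…RhoLayerPairingGlueAwayTwo.lean` and calls these by name.

* `layerCores_conjMap_galoisRep` — `Cor (g · y) = g · Cor y` for every `g ∈ Γ_ℚ` and EVERY `T : GaloisRep ℚ A M` (the tree's
  `Kato2004.layerCores_conjMap` is the `T_pW` case), `layerCores_conjMap_of_compat` (a norm-compatible family stays norm-compatible after
  conjugation — the conjugate cosets `c` of (C5)).
* `exists_locd_of_layerCores_from` — for a pinned `I : IwasawaH1DataCoeff T p κ γ`, a directed system `(G, f)` over `ℕ` and layer pairings
  `pair i : H¹(Γ_{n₀+i}, T) →+ (G i →+ ℤ_p)` with (P1) at every step: ONE additive `locd : I.H →+ (colim G →+ ℤ_p)` with the LAYER FORMULA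
  `locd x [y]_i = pair i (I.proj (n₀+i) x) y`; `locd_unique_of_layer_formula` — it is unique.

References: [NeukirchSchmidtWingberg2008] I §5 Prop. 1.5.4, (1.5.6)–(1.5.7); [Kato2004Asterisque] §12.2 (p. 220); [PerrinRiou1994Invent] §3.6.1;
[Sprung2012] Lemma 7.10 (p. 1503). BSD is not proved by any of this; RSL_g (22608) is not proved here.
-/

set_option autoImplicit false
-- the Theorems namespace of this sub repeats the summit name by design (D-0017 nested layout)
set_option linter.dupNamespace false

noncomputable section

open scoped Classical

namespace Summit.BirchSwinnertonDyer.BirchSwinnertonDyer.Theorems.ThetaTransport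

open CategoryTheory Field
  Literature.NumberTheory.EllipticCurves Literature.NumberTheory.GaloisRepresentations
  Literature.NumberTheory.EllipticCurves.Kato2004 ZpExtension

/-! ## §1 Kato's trace map commutes with conjugation, for any coefficient representation -/

/-- **`Cor (g · y) = g · Cor y`** for every `g ∈ Γ_ℚ` and EVERY `p`-adic representation `T` of `Γ_ℚ` (Kato's trace `layerCores` between consecutive
layers of a `ℤ_p`-extension; `coresLe_conjMap` for the normal layers `Γ_{n+1} ≤ Γ_n`). The tree's `Kato2004.layerCores_conjMap` is the `T_pW` case;
the proof is coefficient-generic. Credit: card k2-g11 §4b. [cite: NeukirchSchmidtWingberg2008, I §5 Prop. 1.5.4] [cite: Kato2004Asterisque, §12.2 (p. 220)] -/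
theorem layerCores_conjMap_galoisRep {p : ℕ} [Fact p.Prime] {A : Type} [CommRing A] [TopologicalSpace A] {M : Type} [AddCommGroup M]
    [Module A M] [TopologicalSpace M] [IsTopologicalAddGroup M] [ContinuousSMul A M] (T : GaloisRep ℚ A M) (κ : ZpExtension ℚ p) (n : ℕ)
    (g : absoluteGaloisGroup ℚ) (y : H1 T (κ.layerSubgroup (n + 1))) :
    layerCores T κ n (conjMap T.toTopRep (κ.layerSubgroup (n + 1)) g 1 y) =
      conjMap T.toTopRep (κ.layerSubgroup n) g 1 (layerCores T κ n y) := by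
  letI : (κ.layerSubgroup (n + 1)).FiniteIndex := finiteIndex_of_isOpen_of_compactSpace _ (κ.isOpen_layerSubgroup (n + 1))
  letI : Fintype (κ.layerSubgroup n ⧸ (κ.layerSubgroup (n + 1)).subgroupOf (κ.layerSubgroup n)) := Fintype.ofFinite _
  have h := coresLe_conjMap T.toTopRep (κ.layerSubgroup_antitone (Nat.le_succ n)) (κ.isOpen_layerSubgroup (n + 1)) g y
  unfold layerCores
  convert h using 2

/-- Corollary: a norm-compatible family stays norm-compatible after conjugation by `g ∈ Γ_ℚ` (levelwise) — the conjugated family `n ↦ g · x_n`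
of the conjugate cosets of (C5). Credit: card k2-g11 §4b. [cite: Kato2004Asterisque, §12.2 (p. 220)] -/
theorem layerCores_conjMap_of_compat {p : ℕ} [Fact p.Prime] {A : Type} [CommRing A] [TopologicalSpace A] {M : Type} [AddCommGroup M]
    [Module A M] [TopologicalSpace M] [IsTopologicalAddGroup M] [ContinuousSMul A M] (T : GaloisRep ℚ A M) (κ : ZpExtension ℚ p)
    (g : absoluteGaloisGroup ℚ) (y : ∀ n : ℕ, H1 T (κ.layerSubgroup n)) (hy : ∀ n, layerCores T κ n (y (n + 1)) = y n) (n : ℕ) :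
    layerCores T κ n (conjMap T.toTopRep (κ.layerSubgroup (n + 1)) g 1 (y (n + 1))) = conjMap T.toTopRep (κ.layerSubgroup n) g 1 (y n) := by
  rw [layerCores_conjMap_galoisRep, hy]

/-! ## §2 An eventually-(P1) family of layer functionals glues on the direct limit -/

/-- **Glue from an eventually-(P1) family** (the `S₀`-version of K-c §3 `exists_locd₂_of_layerCores`). Levels are re-indexed from `n₀` (at `w ∈ S₀`:
`n₀ = n_w`; level `i` = tower layer `n₀ + i`, `G i = H¹(U_{n₀+i,w}, A_ρ[2^k])` or any model of the finite-level local classes, `f` = the restrictions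
`res_{U_{n+1}}^{U_n}`, so that `AddCommGroup.DirectLimit G f` models `D_w = H¹(U_{∞,w}, ·) = colim_n`). For Kato's datum `I` (`I.cores_proj`) and level
pairings `pair i : H¹(Γ_{n₀+i}, T) →+ (G i →+ ℤ_p)` satisfying (P1) at every step `i → i+1`, there is ONE additive `locd : 𝐇¹ →+ (colim G →+ ℤ_p)` with
the LAYER FORMULA `locd x [y]_i = pair i (proj (n₀+i) x) y`. Proof: (P1) + `cores_proj` ⇒ the family `i ↦ pair i (proj (n₀+i) x)` is compatible
with `f` (induction on `i ≤ j`), then `AddCommGroup.DirectLimit.lift`; additivity in `x` by `DirectLimit.induction_on`. Credit: card k2-g11 §5.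
[cite: Kato2004Asterisque, §12.2 (p. 220)] [cite: PerrinRiou1994Invent, §3.6.1] [cite: Sprung2012, Lemma 7.10 (p. 1503)] -/
theorem exists_locd_of_layerCores_from {p : ℕ} [Fact p.Prime] {A : Type} [CommRing A] [TopologicalSpace A] {M : Type}
    [AddCommGroup M] [Module A M] [TopologicalSpace M] [IsTopologicalAddGroup M] [ContinuousSMul A M] {T : GaloisRep ℚ A M}
    {κ : ZpExtension ℚ p} {γ : absoluteGaloisGroup ℚ} (I : IwasawaH1DataCoeff T p κ γ) (n₀ : ℕ)
    (G : ℕ → Type) [∀ i, AddCommGroup (G i)] (f : ∀ i j : ℕ, i ≤ j → G i →+ G j) [DirectedSystem G fun i j h => f i j h]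
    (pair : ∀ i : ℕ, H1 T (κ.layerSubgroup (n₀ + i)) →+ (G i →+ ℤ_[p]))
    (hP1 : ∀ (i : ℕ) (x : H1 T (κ.layerSubgroup (n₀ + i + 1))) (y : G i),
      pair i (layerCores T κ (n₀ + i) x) y = pair (i + 1) x (f i (i + 1) (Nat.le_succ i) y)) :
    ∃ locd : I.H →+ (AddCommGroup.DirectLimit G f →+ ℤ_[p]),
      ∀ (i : ℕ) (x : I.H) (y : G i), locd x (AddCommGroup.DirectLimit.of G f i y) = pair i (I.proj (n₀ + i) x) y := by
  classical
  -- one step: `pair (i+1) (proj_{n₀+i+1} x) (f y) = pair i (proj_{n₀+i} x) y` ((P1) + `cores_proj`)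
  have hstep : ∀ (i : ℕ) (x : I.H) (y : G i),
      pair (i + 1) (I.proj (n₀ + i + 1) x) (f i (i + 1) (Nat.le_succ i) y) = pair i (I.proj (n₀ + i) x) y := fun i x y => by
    rw [← hP1 i (I.proj (n₀ + i + 1) x) y, I.cores_proj (n₀ + i) x]
  -- all steps `i ≤ j`
  have hcompat : ∀ (x : I.H) (i j : ℕ) (hij : i ≤ j) (y : G i),
      pair j (I.proj (n₀ + j) x) (f i j hij y) = pair i (I.proj (n₀ + i) x) y := fun x i j hij y => by
    induction j, hij using Nat.le_induction with
    | base => rw [DirectedSystem.map_self' f]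
    | succ j hij ih =>
      rw [← DirectedSystem.map_map' f hij (Nat.le_succ j)]
      exact (hstep j x (f i j hij y)).trans ih
  -- the glued functional, for each `x`
  let g : I.H → (AddCommGroup.DirectLimit G f →+ ℤ_[p]) := fun x =>
    AddCommGroup.DirectLimit.lift G f ℤ_[p] (fun i => pair i (I.proj (n₀ + i) x)) (fun i j hij y => hcompat x i j hij y)
  have hg : ∀ (x : I.H) (i : ℕ) (y : G i), g x (AddCommGroup.DirectLimit.of G f i y) = pair i (I.proj (n₀ + i) x) y :=
    fun x i y => AddCommGroup.DirectLimit.lift_of _ _ _ i y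
  refine ⟨{ toFun := g, map_zero' := ?_, map_add' := fun x x' => ?_ }, fun i x y => hg x i y⟩
  · refine AddMonoidHom.ext fun z => ?_
    induction z using AddCommGroup.DirectLimit.induction_on with
    | ih i y => rw [hg, map_zero, map_zero, AddMonoidHom.zero_apply, AddMonoidHom.zero_apply]
  · refine AddMonoidHom.ext fun z => ?_
    induction z using AddCommGroup.DirectLimit.induction_on with
    | ih i y => rw [AddMonoidHom.add_apply, hg, hg, hg, map_add, map_add, AddMonoidHom.add_apply]

/-- **Uniqueness of the glue**: two additive functionals with the layer formula agree (every class of the colimit is some `[y]_i`). Credit: card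
k2-g11 §5. [cite: Sprung2012, Lemma 7.10 (p. 1503)] [cite: Kato2004Asterisque, §12.2 (p. 220)] -/
theorem locd_unique_of_layer_formula {p : ℕ} [Fact p.Prime] {A : Type} [CommRing A] [TopologicalSpace A] {M : Type}
    [AddCommGroup M] [Module A M] [TopologicalSpace M] [IsTopologicalAddGroup M] [ContinuousSMul A M] {T : GaloisRep ℚ A M}
    {κ : ZpExtension ℚ p} {γ : absoluteGaloisGroup ℚ} (I : IwasawaH1DataCoeff T p κ γ) (n₀ : ℕ)
    (G : ℕ → Type) [∀ i, AddCommGroup (G i)] (f : ∀ i j : ℕ, i ≤ j → G i →+ G j) [DirectedSystem G fun i j h => f i j h]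
    (pair : ∀ i : ℕ, H1 T (κ.layerSubgroup (n₀ + i)) →+ (G i →+ ℤ_[p]))
    {locd locd' : I.H →+ (AddCommGroup.DirectLimit G f →+ ℤ_[p])}
    (h : ∀ (i : ℕ) (x : I.H) (y : G i), locd x (AddCommGroup.DirectLimit.of G f i y) = pair i (I.proj (n₀ + i) x) y)
    (h' : ∀ (i : ℕ) (x : I.H) (y : G i), locd' x (AddCommGroup.DirectLimit.of G f i y) = pair i (I.proj (n₀ + i) x) y) :
    locd = locd' := by
  classical
  refine AddMonoidHom.ext fun x => AddMonoidHom.ext fun z => ?_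
  induction z using AddCommGroup.DirectLimit.induction_on with
  | ih i y => rw [h, h']

end Summit.BirchSwinnertonDyer.BirchSwinnertonDyer.Theorems.ThetaTransport

end
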